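import Literature.AlgebraicGeometry.HodgeTheory.GysinHodgeClassLift
import Literature.AlgebraicGeometry.HodgeTheory.ClassesSupportedOn
import Literature.AlgebraicGeometry.HodgeTheory.LefschetzOneOne
import Literature.AlgebraicGeometry.HodgeTheory.CorrespondenceSupportedVanishing
import HarnessLib

/-!
# Rational Hodge classes of degree `2p + 2` supported in codimension `≥ p` are algebraic
(Voisin 2013, proof of Lemma 2.1), proved from the tree's named facts

Family `hodge`, layer `Literature/AlgebraicGeometry/HodgeTheory`. Consumer: the support item
`SubmaximalConiveauHodgeClassesAlgebraic` (stmt-HodgeConjecture-1912) of the route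
`Summits/HodgeConjecture/HodgeConjecture/Theses/ConiveauLadderCubicEightfolds` ("on a smooth
projective `X/ℂ`, a RATIONAL class of Hodge type `(p+1, p+1)` in `H^{2p+2}(X(ℂ); ℂ)` that is
supported in codimension `≥ p` is algebraic"; used there at `(n, p) = (8, 3)`), filed as the cite
item "Voisin2013 Lemma 2.1". Source read, verbatim (C. Voisin, *The generalized Hodge and Bloch
conjectures are equivalent for general complete intersections*, Ann. Sci. ÉNS 46 (2013),
arXiv:1107.2600, p. 6):

> **Lemma 2.1.** Conjecture 1.2 is satisfied by codimension `k` cycles whose cohomology class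
> vanishes away from a codimension `k − 1` closed algebraic subset. […] *Proof.* Indeed, if we have
> a codimension `k` cycle `Z ⊂ X`, whose cohomology class `[Z] ∈ H²ᵏ(X, ℚ)` vanishes on the open
> set `X ∖ Y`, where `codim Y ≥ k − 1`, then we know (cf. [Voisin, *Lectures on the Hodge and
> Grothendieck–Hodge conjectures*, Rend. Sem. Mat. Univ. Politec. Torino 69 (2011)]) that there
> are Hodge classes `αᵢ ∈ Hdg^{2k−2cᵢ}(Ỹᵢ, ℚ)`, such that `[Z] = Σᵢ j̃ᵢ*αᵢ`, where `j̃ᵢ : Ỹᵢ → X`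
> are desingularizations of the irreducible components `Yᵢ` of `Y`, and `cᵢ := codim Yᵢ`. As
> `cᵢ ≥ k − 1` for all `i`'s, the classes `αᵢ` are cycle classes on `Ỹᵢ` by the Lefschetz theorem
> on `(1,1)`-classes, which concludes the proof.

The decomposition step is Grothendieck's description of the filtration by codimension of support
(A. Grothendieck, Topology 8 (1969), p. 300, verbatim: "`Filt'ᵖ` can be also described as the space
generated by the images of the Gysin homomorphisms `H^{i−2q}(Y^{an}, ℚ) → Hⁱ(X^{an}, ℚ)` for
desingularizations `Y` of closed subschemes `T` of `X` which are of pure codimension `q ≥ p`")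
combined with the semisimplicity of polarisable Hodge structures to lift the Hodge class. The
printed argument uses of `[Z]` only that it is a rational Hodge class, and proves: *a rational
Hodge class of degree `2k` vanishing on `X ∖ Y`, `codim Y ≥ k − 1`, is a combination of Gysin
images of divisor (or degree-`0`) classes on the `Ỹᵢ`, hence an algebraic class supported on `Y`.*
This file PROVES that statement (with `k = p + 1`) on the tree's carriers — `complexBetti`,
`IsRationalClass`, `IsOfHodgeType`, `supportedClasses X i r = Nʳ Hⁱ(X(ℂ); ℂ)`,
`algebraicClasses X q = N^q H^{2q}` (`HodgeTheory/AlgebraicClasses`) — from the tree's EXISTING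
named facts for its three printed ingredients, introducing no new named fact (D-0026):

* `hA : Deligne1974_ker_restrictCompl_eq_iSup_range_complexGysin` (`HodgeTheory/GysinKernel`;
  Deligne, Hodge III, Cor. 8.2.8): `ker (Hᵇ(X(ℂ)) → Hᵇ((X ∖ ⋃ⱼ gⱼ(Yⱼ))(ℂ))) = Σⱼ im (gⱼ)_*`;
* `hB : Voisin2025_hodgeClass_lift_complexGysin` (`HodgeTheory/GysinHodgeClassLift`; Voisin 2025,
  Cor. 2.12 = semisimplicity of polarisable Hodge structures, Voisin I Lemma 7.26 — the content of
  the Torino-lectures citation): a rational `(q,q)`-class in `Σⱼ im (gⱼ)_*` is a `ℂ`-combination of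
  `(gⱼ)_* bⱼ` with `bⱼ` rational of type `(dⱼ, dⱼ)`, `dⱼ + (n − mⱼ) = q`; the two are already
  chained in the tree (`Voisin2025_hodgeClass_lift_complexGysin.mem_iSup_map_of_restrictCompl_eq_zero`);
* `hH : Resolution.Hironaka1964_projective` (Kollár 2007, Thm. 3.27): the desingularisations `j̃ᵢ`;
* `hL : lefschetzOneOne_rational` (`HodgeTheory/LefschetzOneOne`; Voisin I, Thm. 11.30): rational
  `(1,1)`-classes are divisor classes, `∈ algebraicClasses Ỹᵢ 1`;
* `hS : AlgebraicTopology.SingularHomology.gysinMap_restrictCompl_eq_zero ℂ`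
  (`SingularHomology/GysinMapSupport`; Fulton, *Young Tableaux*, App. B §B.2 Ex. 5): Gysin maps are
  compatible with restriction to open subsets — the step "push the divisors forward", left implicit
  in print (`j̃ᵢ*` of a cycle class is the class of the image cycle);

all relative to an orientation family `μ` with Poincaré duality (`HodgeTheory/ComplexGysin`), as
every statement about the real Gysin morphisms `complexGysin μ` in the tree (the images
`im (gⱼ)_*` do not depend on `μ`; see `GysinKernel`, "Remarks on faithfulness").

## Contents (all proved)

* `exists_support_of_mem_supportedClasses`, `mem_supportedClasses_iff_exists` — a class of
  `Nʳ Hⁱ` (a sum over closed supports) dies off ONE Zariski-closed subset of codimension `≥ r`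
  (finite unions; monotonicity in the support).
* `restrictCompl_complexGysin_eq_zero_of_image_subset`, `complexGysin_mem_supportedClasses`,
  `map_complexGysin_algebraicClasses_le` — from `hS`: a class dying off `S ⊆ Y` has Gysin image
  dying off `f(S)`; `f_*(Nʳ Hᵃ(Y)) ⊆ Nˢ Hᵇ(X)` for `s + dim Y ≤ dim X + r`; in particular
  `g_*(algebraicClasses W d) ≤ algebraicClasses X (d + e)`, `dim X = dim W + e` — the
  `complexGysin` counterparts of `GysinFormalism.gysin_mem_supportedClasses`
  (`HodgeTheory/GysinFormalismPushforward`), and the shape of the support item "Gysin images of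
  algebraic classes are algebraic" of the route `CurveNetMordellWeil`.
* `exists_family_iUnion_range_eq_of_isClosed` — from `hH`: a Zariski-closed `Z ⊆ X` all of whose
  points have codimension `≥ r` is the joint image `⋃ⱼ gⱼ(Yⱼ)` of finitely many morphisms from
  smooth projective `Yⱼ` of dimensions `mⱼ ≤ n − r` (irreducible components of the Noetherian `Z`;
  reduced structure `Motives.ClosedSubvariety.ofPoint` on `closure {ηⱼ}`; `dim + codim = n`,
  Hartshorne II Ex. 3.20; a projective resolution is proper and dominant, hence onto).
* `mem_iSup_map_complexGysin_of_restrictCompl_eq_zero_of_ne_univ` — from `hA`, `hB`, `hH`: the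
  decomposition step for an arbitrary closed `Y ≠ X` (a rational `(q,q)`-class dying on
  `(X ∖ Y)(ℂ)` is a `ℂ`-combination of `g_* b`, `g : W ⟶ X`, `dim W = n − e`, `1 ≤ e ≤ q`, `b`
  rational of type `(q − e, q − e)`) — the shape of the support item `DeligneDescent` of the
  route `CurveNetMordellWeil`.
* `exists_support_subset_of_restrictCompl_eq_zero_of_isOfHodgeType` — **the printed lemma in
  full**: a rational `(p+1, p+1)`-class dying on `(X ∖ Y)(ℂ)`, `Y` closed of codimension `≥ p`,
  dies off a closed `W ⊆ Y` of codimension `≥ p + 1` (an algebraic class supported on the SAME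
  `Y`); bookkeeping `dⱼ + (n − mⱼ) = p + 1`, `mⱼ ≤ n − p`, so `dⱼ ≤ 1`, and `(gⱼ)_* bⱼ` dies off
  `gⱼ(Sⱼ) ⊆ Y` when `bⱼ` dies off `Sⱼ`.
* `mem_algebraicClasses_of_mem_supportedClasses_of_isOfHodgeType` — **the theorem the consumer
  uses**: for `X` smooth projective of dimension `n`, `c ∈ Nᵖ H^{2p+2}(X(ℂ); ℂ)` rational of type
  `(p+1, p+1)` lies in `algebraicClasses X (p + 1) = N^{p+1} H^{2p+2}`.
* `supportedHodgeClass_algebraic_of_facts` — the same in the exact shape of the route item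
  (`∀ n X, IsSmoothProjective n X → ∀ p c, c ∈ supportedClasses X (2(p+1)) p → IsRationalClass c →
  IsOfHodgeType n X (2(p+1)) (p+1) (p+1) c → c ∈ algebraicClasses X (p+1)`), and
  `mem_algebraicClasses_one_of_isOfHodgeType` — its slice `p = 0`, which is `hL` alone.

Remarks on faithfulness. (1) Voisin's `Y` of "codim `≥ k − 1`" is rendered pointwise
(`∀ z ∈ Y, k − 1 ≤ coheight z`), as in the tree's `supportedClasses`; her conclusion "Conjecture 1.2
holds for `[Z]`" (the class is that of a `ℚ`-cycle supported on `Y`) is rendered as membership in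
`N^{p+1} H^{2p+2} = algebraicClasses X (p+1)`, the tree's space of algebraic classes (module
docstring of `HodgeTheory/AlgebraicClasses`); the finer "supported on the same `Y`" is visible in
the proof (the supports produced lie in `⋃ⱼ gⱼ(Yⱼ) = Y`) but not recorded in the statement the
consumer asked for. (2) Nothing is asserted unconditionally: the five hypotheses are named facts
of the tree with their own cites and discharge seats; this file adds none.

## References

* [Voisin2013GHCBloch] C. Voisin, The generalized Hodge and Bloch conjectures are equivalent for
  general complete intersections, Ann. Sci. ÉNS 46 (2013) 449–475, Lemma 2.1 and its proof
  (arXiv:1107.2600, p. 6).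
* [DeligneHodgeIII1974] P. Deligne, Théorie de Hodge III, Publ. Math. IHÉS 44 (1974), Cor. 8.2.8.
* [Voisin2025] C. Voisin, Hodge and generalized Hodge conjectures, coniveau and algebraic cycles,
  J. Open Math. Probl. 1 (2025), Prop. 2.11, Cor. 2.12, Cor. 4.5.
* [VoisinHodgeI2002] C. Voisin, Hodge Theory and Complex Algebraic Geometry I, Thm. 11.30, §11.3.3,
  Lemma 7.26, §7.3.2.
* [GrothendieckTopology1969] A. Grothendieck, Hodge's general conjecture is false for trivial
  reasons, Topology 8 (1969) 299–303, p. 299 (the "arithmetic" filtration `Filt'ᵖ` by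
  codimension of support) and p. 300 (`Filt'ᵖ` is generated by Gysin images of
  desingularisations of closed subschemes of pure codimension `q ≥ p`).
* [Kollar2007] J. Kollár, Lectures on Resolution of Singularities, Thm. 3.27.
* [FultonYoungTableaux1997] W. Fulton, Young Tableaux, App. B §B.2 Exercise 5.
* [Hartshorne1977] R. Hartshorne, Algebraic Geometry, II Ex. 3.20, II Cor. 4.8.
-/

noncomputable section

open CategoryTheory AlgebraicGeometry
open Literature.AlgebraicTopology.SingularHomology

namespace Literature.AlgebraicGeometry.HodgeTheory

section HodgeTheory

variable {m n : ℕ} {Y X : Motives.SchemeOver ℂ}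

/-! ### A class of `Nʳ Hⁱ` dies off a single closed subset of codimension `≥ r` -/

/-- A class in `Nʳ Hⁱ(X(ℂ); ℂ) = supportedClasses X i r` (a SUM of classes dying off closed subsets
of codimension `≥ r`) dies off ONE Zariski-closed subset all of whose points have codimension
`≥ r`: finite unions of such subsets are again such, and a class dying off `Z` dies off every
`Z' ⊇ Z`. [cite: GrothendieckTopology1969, §1] -/
theorem exists_support_of_mem_supportedClasses {i r : ℕ} {x : complexBetti X i}
    (hx : x ∈ supportedClasses X i r) :
    ∃ Z : Set X.left, IsClosed Z ∧ (∀ z ∈ Z, (r : ℕ∞) ≤ Order.coheight z) ∧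
      complexBetti.restrictCompl X Z i x = 0 := by
  let S : Submodule ℂ (complexBetti X i) :=
    { carrier := {x | ∃ Z : Set X.left, IsClosed Z ∧ (∀ z ∈ Z, (r : ℕ∞) ≤ Order.coheight z) ∧
        complexBetti.restrictCompl X Z i x = 0}
      zero_mem' := ⟨∅, isClosed_empty, fun z hz ↦ (Set.notMem_empty z hz).elim, map_zero _⟩
      add_mem' := by
        rintro a b ⟨Z, hZ, hrZ, ha⟩ ⟨W, hW, hrW, hb⟩
        refine ⟨Z ∪ W, hZ.union hW, ?_, ?_⟩
        · rintro z (hz | hz)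
          exacts [hrZ z hz, hrW z hz]
        · rw [map_add, complexBetti.restrictCompl_eq_zero_of_subset Set.subset_union_left ha,
            complexBetti.restrictCompl_eq_zero_of_subset Set.subset_union_right hb, add_zero]
      smul_mem' := by
        rintro c a ⟨Z, hZ, hrZ, ha⟩
        exact ⟨Z, hZ, hrZ, by rw [map_smul, ha, smul_zero]⟩ }
  have h : supportedClasses X i r ≤ S :=
    classesSupportedOn_le_supportedClasses_iff.2 fun Z hZ hrZ y hy ↦
      ⟨Z, hZ, hrZ, mem_classesSupportedOn_iff.1 hy⟩
  exact h hx

/-- `Nʳ Hⁱ(X(ℂ); ℂ)` membership, unfolded: `x ∈ supportedClasses X i r` iff `x` dies off some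
Zariski-closed subset all of whose points have codimension `≥ r`. [cite: GrothendieckTopology1969, §1] -/
theorem mem_supportedClasses_iff_exists {i r : ℕ} {x : complexBetti X i} :
    x ∈ supportedClasses X i r ↔ ∃ Z : Set X.left, IsClosed Z ∧
      (∀ z ∈ Z, (r : ℕ∞) ≤ Order.coheight z) ∧ complexBetti.restrictCompl X Z i x = 0 :=
  ⟨exists_support_of_mem_supportedClasses, fun ⟨_, hZ, hr, h0⟩ ↦
    mem_supportedClasses_of_restrictCompl_eq_zero hZ hr h0⟩

/-! ### Gysin images of supported classes (support form of Fulton, App. B §B.2 Ex. 5) -/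

/-- **Gysin images of classes dying off `S` die off `f(S)`.** For `f : Y ⟶ X` between smooth
projective varieties, a subset `S ⊆ Y`, a Zariski-closed `T ⊆ X` containing `f(S)`, and a class
`y ∈ Hᵃ(Y(ℂ); ℂ)` vanishing on `(Y ∖ S)(ℂ)`, the Gysin image `f_* y ∈ Hᵇ(X(ℂ); ℂ)` vanishes on
`(X ∖ T)(ℂ)`: the open set `{P ∈ Y(ℂ) | f(P) ∉ T(ℂ)}` lies in `(Y ∖ S)(ℂ)`, so `y` dies there, and
Gysin maps are compatible with restriction to open subsets (the tree's named fact
`gysinMap_restrictCompl_eq_zero ℂ`, granted as `hS`).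
[cite: FultonYoungTableaux1997, Appendix B §B.2 Exercise 5] [cite: GrothendieckTopology1969, §1] -/
theorem restrictCompl_complexGysin_eq_zero_of_image_subset
    (hS : gysinMap_restrictCompl_eq_zero.{0, 0} ℂ)
    (μ : OrientationFamily) (hμ : μ.HasPoincareDuality) (hY : Motives.IsSmoothProjective m Y)
    (hX : Motives.IsSmoothProjective n X) (f : Y ⟶ X) {S : Set Y.left} {T : Set X.left}
    (hT : IsClosed T) (hST : f.left.base '' S ⊆ T) {a b : ℕ} (hab : a + 2 * n = b + 2 * m)
    {y : complexBetti Y a} (hy : complexBetti.restrictCompl Y S a y = 0) :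
    complexBetti.restrictCompl X T b (complexGysin μ hY hX f hab y) = 0 := by
  by_cases ha : a ≤ 2 * m
  · rw [complexGysin_eq_gysinMap hY hX f hab (q := 2 * m - a) (by omega) (by omega)]
    letI := hY.chartedSpace
    letI := hX.chartedSpace
    haveI := Motives.ComplexPoints.compactSpace_of_isSmoothProjective hY
    haveI := Motives.ComplexPoints.t2Space_of_isSmoothProjective hY
    haveI := Motives.ComplexPoints.compactSpace_of_isSmoothProjective hX
    haveI := Motives.ComplexPoints.t2Space_of_isSmoothProjective hX
    -- the open set `{P | f(P) ∉ T(ℂ)}` of `Y(ℂ)` lies inside `(Y ∖ S)(ℂ)`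
    let ι : C({P : Motives.ComplexPoints Y //
        Motives.AlgPoints.mapContinuous (L := ℂ) f P ∉ {Q : Motives.ComplexPoints X | Q.pt ∈ T}},
        Motives.complexPointsCompl Y S) :=
      ⟨fun P ↦ ⟨P.1, fun hP ↦ P.2 (hST ⟨P.1.pt, hP, (Motives.AlgPoints.pt_map f P.1).symm⟩)⟩,
        by fun_prop⟩
    have hcomp : (⟨Subtype.val, continuous_subtype_val⟩ :
        C({P : Motives.ComplexPoints Y //
          Motives.AlgPoints.mapContinuous (L := ℂ) f P ∉ {Q : Motives.ComplexPoints X | Q.pt ∈ T}},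
          Motives.ComplexPoints Y)) =
        (⟨Subtype.val, continuous_subtype_val⟩ :
          C(Motives.complexPointsCompl Y S, Motives.ComplexPoints Y)).comp ι := rfl
    refine hS (μ hY) (μ hX) (hμ hX) (Motives.AlgPoints.mapContinuous (L := ℂ) f)
      (show a + (2 * m - a) = 2 * m by omega) (show b + (2 * m - a) = 2 * n by omega)
      (K := {Q : Motives.ComplexPoints X | Q.pt ∈ T}) (isClosed_setOf_pt_mem hT) y ?_
    rw [hcomp, singularCohomology.map_comp, CategoryTheory.comp_apply]
    change singularCohomology.map ℂ ℂ ι a (complexBetti.restrictCompl Y S a y) = 0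
    rw [hy, map_zero]
  · rw [complexGysin_of_lt hY hX f hab (not_le.1 ha), LinearMap.zero_apply, map_zero]

/-- **Gysin images of supported classes are supported on the image**: for `f : Y ⟶ X` between
smooth projective varieties of dimensions `m`, `n` and `y ∈ Nʳ Hᵃ(Y(ℂ); ℂ)`,
`f_* y ∈ Nˢ Hᵇ(X(ℂ); ℂ)` whenever `s + m ≤ n + r` — for the REAL Gysin morphisms `complexGysin μ`
(the `GysinFormalism` version is `GysinFormalism.gysin_mem_supportedClasses`): a class dying off a
closed `S` has Gysin image dying off the closed set `f(S)` (`f` is proper), whose points have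
codimension `≥ s` (`le_coheight_of_mem_image`: closed maps do not raise dimensions of points).
[cite: FultonYoungTableaux1997, Appendix B §B.2 Exercise 5] [cite: GrothendieckTopology1969, §1] -/
theorem complexGysin_mem_supportedClasses (hS : gysinMap_restrictCompl_eq_zero.{0, 0} ℂ)
    (μ : OrientationFamily) (hμ : μ.HasPoincareDuality) (hY : Motives.IsSmoothProjective m Y)
    (hX : Motives.IsSmoothProjective n X) (f : Y ⟶ X) {a b : ℕ} (hab : a + 2 * n = b + 2 * m)
    {r s : ℕ} (hrs : s + m ≤ n + r) {y : complexBetti Y a} (hy : y ∈ supportedClasses Y a r) :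
    complexGysin μ hY hX f hab y ∈ supportedClasses X b s := by
  have hf : IsClosedMap f.left.base :=
    haveI := isProper_left_of_isSmoothProjective hY hX f
    f.left.isClosedMap
  obtain ⟨S, hSc, hr, hy0⟩ := exists_support_of_mem_supportedClasses hy
  exact mem_supportedClasses_of_restrictCompl_eq_zero (hf _ hSc)
    (fun x hx ↦ le_coheight_of_mem_image hY hX f hf hr hrs hx)
    (restrictCompl_complexGysin_eq_zero_of_image_subset hS μ hμ hY hX f (hf _ hSc) subset_rfl
      hab hy0)

/-- **Gysin images of algebraic classes are algebraic**, with the codimension shift: for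
`g : W ⟶ X` of smooth projective varieties, `dim W = m`, `dim X = n = m + e`,
`g_*(Nᵈ H²ᵈ(W(ℂ); ℂ)) ⊆ N^{d+e} H^{2d+2e}(X(ℂ); ℂ)`, i.e.
`g_*(algebraicClasses W d) ≤ algebraicClasses X (d + e)` (push the supporting subvarieties
forward). [cite: FultonYoungTableaux1997, Appendix B §B.2 Exercise 5] [cite: GrothendieckTopology1969, §1] -/
theorem map_complexGysin_algebraicClasses_le (hS : gysinMap_restrictCompl_eq_zero.{0, 0} ℂ)
    (μ : OrientationFamily) (hμ : μ.HasPoincareDuality) {m n d e : ℕ} {W X : Motives.SchemeOver ℂ}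
    (hW : Motives.IsSmoothProjective m W) (hX : Motives.IsSmoothProjective n X) (g : W ⟶ X)
    (hm : m + e = n) :
    (algebraicClasses W d).map
        (complexGysin μ hW hX g (show 2 * d + 2 * n = 2 * (d + e) + 2 * m by omega)) ≤
      algebraicClasses X (d + e) := by
  rintro _ ⟨y, hy, rfl⟩
  exact complexGysin_mem_supportedClasses hS μ hμ hW hX g _ (by omega) hy

/-! ### Resolving the support: a closed subset of codimension `≥ r` is the joint image of
smooth projective varieties of dimension `≤ n - r` (Hironaka) -/

/-- **Desingularising the components of a closed subset.** Let `X` be smooth projective of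
dimension `n` over `ℂ` and `Z ⊆ X` Zariski-closed, all of whose points have codimension `≥ r`.
Then `Z = ⋃ⱼ gⱼ(Yⱼ)` for a finite family of morphisms `gⱼ : Yⱼ ⟶ X` from smooth projective varieties
`Yⱼ` of dimensions `mⱼ` with `mⱼ + r ≤ n`: write `Z` as the union of its finitely many irreducible
components `Zⱼ = closure {ηⱼ}` (`X` is Noetherian), give `Zⱼ` its reduced structure
(`Motives.ClosedSubvariety.ofPoint`, an integral projective variety of dimension
`dim Zⱼ = height ηⱼ = n - codim ηⱼ ≤ n - r`), and take a projective resolution `πⱼ : Yⱼ → Zⱼ`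
(Hironaka, projective form: Kollár 2007, Thm. 3.27, the tree's named fact
`Resolution.Hironaka1964_projective`, granted as `hH`), which is birational and proper, hence
surjective; `gⱼ := πⱼ ≫ (Zⱼ ↪ X)` ("`j̃ᵢ : Ỹᵢ → X` desingularizations of the irreducible components
`Yᵢ` of `Y`, and `cᵢ := codim Yᵢ`"). [cite: Voisin2013GHCBloch, proof of Lemma 2.1]
[cite: Kollar2007, Thm. 3.27] [cite: Hartshorne1977, II Ex. 3.20] -/
theorem exists_family_iUnion_range_eq_of_isClosed (hH : Resolution.Hironaka1964_projective.{0})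
    (hX : Motives.IsSmoothProjective n X) {Z : Set X.left} (hZ : IsClosed Z) {r : ℕ}
    (hr : ∀ z ∈ Z, (r : ℕ∞) ≤ Order.coheight z) :
    ∃ (ι : Type) (_ : Finite ι) (m : ι → ℕ) (Y : ι → Motives.SchemeOver ℂ)
      (_ : ∀ j, Motives.IsSmoothProjective (m j) (Y j)) (g : ∀ j, Y j ⟶ X),
      (⋃ j, Set.range (g j).left.base) = Z ∧ ∀ j, m j + r ≤ n := by
  haveI := noetherianSpace_of_isSmoothProjective hX
  obtain ⟨S, hSf, hSc, hSi, hZS⟩ :=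
    TopologicalSpace.NoetherianSpace.exists_finite_set_isClosed_irreducible hZ
  -- resolve each irreducible component
  have key : ∀ t : S, ∃ (m : ℕ) (Y : Motives.SchemeOver ℂ) (_ : Motives.IsSmoothProjective m Y)
      (g : Y ⟶ X), Set.range g.left.base = (t : Set X.left) ∧ m + r ≤ n := by
    rintro ⟨t, ht⟩
    set η : X.left := (hSi t ht).genericPoint with hη
    have hηt : closure {η} = t := (hSi t ht).closure_genericPoint (hSc t ht)
    have hηZ : η ∈ Z := by
      rw [hZS]
      exact Set.mem_sUnion_of_mem ((hSi t ht).isGenericPoint_genericPoint (hSc t ht)).mem ht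
    set X₀ := Motives.ClosedSubvariety.ofPoint X.left η with hX₀
    haveI : IsIntegral X₀.toSchemeOver.left := inferInstanceAs (IsIntegral X₀.carrier)
    obtain ⟨d, Y, π, hY, hπ, hdim⟩ :=
      hH ℂ X₀.toSchemeOver (isProjectiveOver_toSchemeOver X₀ hX.isProjectiveOver)
    -- `d = dim X₀ = height η` and `height η + codim η = n`, `codim η ≥ r`
    have hdr : d + r ≤ n := by
      have e1 : X₀.ι.base (genericPoint X₀.carrier) = η :=
        Motives.ClosedSubvariety.genericPoint_ofPoint η
      have e2 : Order.height (X₀.ι.base (genericPoint X₀.carrier)) =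
          Order.height (genericPoint X₀.carrier) :=
        Motives.Scheme.height_base_eq_of_isClosedImmersion _ _
      have h1 : Order.height η = (d : ℕ∞) := by
        rw [← e1, e2]
        exact hdim
      obtain ⟨a, c, ha, hc, hac⟩ := exists_height_eq_coheight_eq hX η
      have h2 := hr η hηZ
      rw [hc] at h2
      rw [ha] at h1
      have h1' : a = d := by exact_mod_cast h1
      have h2' : r ≤ c := by exact_mod_cast h2
      omega
    -- `π` is proper (source proper, target separated over `ℂ`) and dominant, hence surjective
    haveI : IsProper Y.hom := Motives.IsSmoothProjective.isProper_holds hY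
    haveI : IsProper X.hom := Motives.IsSmoothProjective.isProper_holds hX
    haveI : IsSeparated X₀.toSchemeOver.hom :=
      inferInstanceAs (IsSeparated (X₀.ι ≫ X.hom))
    haveI : IsProper π.left := by
      have h : IsProper (π.left ≫ X₀.toSchemeOver.hom) := by
        rw [Over.w π]
        infer_instance
      exact MorphismProperty.of_postcomp (W := @IsProper) (W' := @IsSeparated) π.left
        X₀.toSchemeOver.hom inferInstance h
    haveI : IsDominant π.left := by
      obtain ⟨U, hU, -, hiso⟩ := hπ
      haveI : IsDominant U.ι := ⟨by rw [DenseRange, Scheme.Opens.range_ι]; exact hU⟩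
      haveI : IsDominant ((π.left ⁻¹ᵁ U).ι ≫ π.left) := by
        rw [← morphismRestrict_ι]
        infer_instance
      exact IsDominant.of_comp (π.left ⁻¹ᵁ U).ι π.left
    haveI : Surjective π.left :=
      surjective_of_isDominant_of_isClosed_range π.left π.left.isClosedMap.isClosed_range
    refine ⟨d, Y, hY, π ≫ X₀.ιOver, ?_, hdr⟩
    rw [Over.comp_left, Motives.ClosedSubvariety.ιOver_left, Scheme.Hom.comp_base, TopCat.coe_comp,
      Set.range_comp, π.left.surjective.range_eq, Set.image_univ]
    exact (Motives.ClosedSubvariety.range_ofPoint_ι η).trans hηt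
  choose m Y hY g hg hm using key
  refine ⟨S, hSf.to_subtype, m, Y, hY, g, ?_, hm⟩
  rw [hZS, Set.sUnion_eq_iUnion]
  exact Set.iUnion_congr fun t ↦ hg t

/-! ### The decomposition step for an arbitrary proper closed subset (Deligne descent) -/

/-- **Deligne descent off a proper closed subset** (the first half of the printed proof, for any
`Y ⊊ X`): for `X` smooth projective of dimension `n`, `Y ⊆ X` Zariski-closed and `≠ X`, and a
rational class `c ∈ H^{2q}(X(ℂ); ℂ)` of Hodge type `(q, q)` vanishing on `(X ∖ Y)(ℂ)`, `c` lies in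
the `ℂ`-span of Gysin images `g_* b`, `g : W ⟶ X` from smooth projective `W` of dimension
`m = n − e` with `1 ≤ e`, `d + e = q`, `b ∈ H^{2d}(W(ℂ); ℂ)` rational of type `(d, d)` ("there are
Hodge classes `αᵢ ∈ Hdg^{2k−2cᵢ}(Ỹᵢ, ℚ)` such that `[Z] = Σᵢ j̃ᵢ*αᵢ`"): the tree's
`Voisin2025_hodgeClass_lift_complexGysin.mem_iSup_map_of_lt` (facts `hA`, `hB`) fed with the
desingularisations of the components of `Y` (`exists_family_iUnion_range_eq_of_isClosed`, fact
`hH`; the components of `Y ≠ X` have codimension `≥ 1`, `one_le_coheight_of_mem_of_isClosed`).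
This is the shape of the support item `DeligneDescent` of the route
`Summits/HodgeConjecture/HodgeConjecture/Theses/CurveNetMordellWeil`.
[cite: Voisin2013GHCBloch, Lemma 2.1 (proof)] [cite: DeligneHodgeIII1974, Cor. 8.2.8]
[cite: Voisin2025, Cor. 2.12 and Cor. 4.5] [cite: Kollar2007, Thm. 3.27] -/
theorem mem_iSup_map_complexGysin_of_restrictCompl_eq_zero_of_ne_univ
    (hA : Deligne1974_ker_restrictCompl_eq_iSup_range_complexGysin)
    (hB : Voisin2025_hodgeClass_lift_complexGysin)
    (hH : Resolution.Hironaka1964_projective.{0})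
    (μ : OrientationFamily) (hμ : μ.HasPoincareDuality) (hX : Motives.IsSmoothProjective n X)
    {Z : Set X.left} (hZ : IsClosed Z) (hZ' : Z ≠ Set.univ) {q : ℕ} {c : complexBetti X (2 * q)}
    (hc : IsRationalClass c) (hc' : IsOfHodgeType n X (2 * q) q q c)
    (h0 : complexBetti.restrictCompl X Z (2 * q) c = 0) :
    c ∈ ⨆ (d : ℕ) (e : ℕ) (_ : d + e = q) (_ : 1 ≤ e) (W : Motives.SchemeOver ℂ) (m' : ℕ)
      (hm' : m' + e = n) (hW : Motives.IsSmoothProjective m' W) (g' : W ⟶ X),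
      (Submodule.span ℂ {b : complexBetti W (2 * d) |
          IsRationalClass b ∧ IsOfHodgeType m' W (2 * d) d d b}).map
        (complexGysin μ hW hX g' (show 2 * d + 2 * n = 2 * q + 2 * m' by omega)) := by
  obtain ⟨ι, hι, m, Y, hY, g, hZg, hm⟩ := exists_family_iUnion_range_eq_of_isClosed hH hX hZ
    (r := 1) fun z hz ↦ one_le_coheight_of_mem_of_isClosed hX hZ hZ' hz
  haveI := hι
  exact Voisin2025_hodgeClass_lift_complexGysin.mem_iSup_map_of_lt hA hB μ hμ hX hY g
    (fun j ↦ by have := hm j; omega) hZg hc hc' h0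

/-! ### Voisin 2013, proof of Lemma 2.1 -/

/-- **Voisin 2013, Lemma 2.1 (the printed conclusion: the class is algebraic AND supported on the
same `Y`).** Let `X` be smooth projective of dimension `n` over `ℂ`, `Y ⊆ X` Zariski-closed all
of whose points have codimension `≥ p`, and `c ∈ H^{2p+2}(X(ℂ); ℂ)` a rational class of Hodge type
`(p+1, p+1)` vanishing on `(X ∖ Y)(ℂ)`. Then `c` vanishes off a Zariski-closed `W ⊆ Y` all of whose
points have codimension `≥ p + 1` — i.e. `c` is an algebraic class supported on `Y` ("Conjecture
1.2 is satisfied by codimension `k` cycles whose cohomology class vanishes away from a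
codimension `k − 1` closed algebraic subset": `[Z] = [Z']` with `Z'` a `ℚ`-cycle supported on
`Y`; here `k = p + 1` and, on the tree's carriers, "class of a cycle of codimension `k` supported
on `Y`" = "class dying off a closed `W ⊆ Y` of codimension `≥ k`", module docstring of
`HodgeTheory/AlgebraicClasses`). Proof as printed: desingularise the components of `Y` (`hH`),
write `c = Σⱼ (gⱼ)_* bⱼ` with `bⱼ` rational of type `(dⱼ, dⱼ)` on `Ỹⱼ` (Grothendieck 1969 p. 300 /
Deligne 8.2.8 `hA`, and the lifting of Hodge classes `hB`), note `dⱼ + (n − dim Ỹⱼ) = p + 1` with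
`dim Ỹⱼ ≤ n − p`, so `dⱼ ≤ 1` and `bⱼ` is a divisor class (Lefschetz `(1,1)`, `hL`) or of degree
`0`, dying off a closed `Sⱼ ⊆ Ỹⱼ` of codimension `≥ dⱼ`; then `(gⱼ)_* bⱼ` dies off
`gⱼ(Sⱼ) ⊆ gⱼ(Ỹⱼ) ⊆ Y`, closed of codimension `≥ p + 1` in `X` (`hS`), and so does the sum, off
`W = ⋃ⱼ gⱼ(Sⱼ)`. [cite: Voisin2013GHCBloch, Lemma 2.1 (proof)] [cite: GrothendieckTopology1969, p. 300]
[cite: DeligneHodgeIII1974, Cor. 8.2.8] [cite: Voisin2025, Cor. 2.12]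
[cite: VoisinHodgeI2002, Thm. 11.30 and §11.3.3] -/
theorem exists_support_subset_of_restrictCompl_eq_zero_of_isOfHodgeType
    (hA : Deligne1974_ker_restrictCompl_eq_iSup_range_complexGysin)
    (hB : Voisin2025_hodgeClass_lift_complexGysin)
    (hS : gysinMap_restrictCompl_eq_zero.{0, 0} ℂ)
    (hH : Resolution.Hironaka1964_projective.{0}) (hL : lefschetzOneOne_rational)
    (μ : OrientationFamily) (hμ : μ.HasPoincareDuality) (hX : Motives.IsSmoothProjective n X)
    (p : ℕ) {c : complexBetti X (2 * (p + 1))} {Z : Set X.left} (hZ : IsClosed Z)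
    (hrZ : ∀ z ∈ Z, (p : ℕ∞) ≤ Order.coheight z)
    (h0 : complexBetti.restrictCompl X Z (2 * (p + 1)) c = 0) (hc : IsRationalClass c)
    (hc' : IsOfHodgeType n X (2 * (p + 1)) (p + 1) (p + 1) c) :
    ∃ W ⊆ Z, IsClosed W ∧ (∀ w ∈ W, ((p + 1 : ℕ) : ℕ∞) ≤ Order.coheight w) ∧
      complexBetti.restrictCompl X W (2 * (p + 1)) c = 0 := by
  -- desingularise the components of `Z`
  obtain ⟨ι, hι, m, Y, hY, g, hZg, hm⟩ := exists_family_iUnion_range_eq_of_isClosed hH hX hZ hrZ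
  haveI := hι
  -- Deligne 8.2.8 + lifting of Hodge classes: `c = Σⱼ (g j)_* bⱼ`, `bⱼ` rational of type `(d, d)`
  have hmem := Voisin2025_hodgeClass_lift_complexGysin.mem_iSup_map_of_restrictCompl_eq_zero
    hA hB μ hμ hX hY g hZg hc hc' h0
  -- the classes dying off some closed `W ⊆ Z` of codimension `≥ p + 1` form a submodule `T`
  let T : Submodule ℂ (complexBetti X (2 * (p + 1))) :=
    { carrier := {x | ∃ W ⊆ Z, IsClosed W ∧ (∀ w ∈ W, ((p + 1 : ℕ) : ℕ∞) ≤ Order.coheight w) ∧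
        complexBetti.restrictCompl X W (2 * (p + 1)) x = 0}
      zero_mem' := ⟨∅, Set.empty_subset _, isClosed_empty,
        fun w hw ↦ (Set.notMem_empty w hw).elim, map_zero _⟩
      add_mem' := by
        rintro a b ⟨W, hWZ, hW, hrW, ha⟩ ⟨W', hWZ', hW', hrW', hb⟩
        refine ⟨W ∪ W', Set.union_subset hWZ hWZ', hW.union hW', ?_, ?_⟩
        · rintro w (hw | hw)
          exacts [hrW w hw, hrW' w hw]
        · rw [map_add, complexBetti.restrictCompl_eq_zero_of_subset Set.subset_union_left ha,
            complexBetti.restrictCompl_eq_zero_of_subset Set.subset_union_right hb, add_zero]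
      smul_mem' := by
        rintro r a ⟨W, hWZ, hW, hrW, ha⟩
        exact ⟨W, hWZ, hW, hrW, by rw [map_smul, ha, smul_zero]⟩ }
  suffices hle : (⨆ (j : ι) (d : ℕ) (hd : 2 * d + 2 * n = 2 * (p + 1) + 2 * m j),
      (Submodule.span ℂ {b : complexBetti (Y j) (2 * d) |
          IsRationalClass b ∧ IsOfHodgeType (m j) (Y j) (2 * d) d d b}).map
        (complexGysin μ (hY j) hX (g j) hd)) ≤ T from hle hmem
  refine iSup_le fun j ↦ iSup_le fun d ↦ iSup_le fun hd ↦ ?_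
  rw [Submodule.map_le_iff_le_comap, Submodule.span_le]
  rintro b ⟨hb, hb'⟩
  rw [SetLike.mem_coe, Submodule.mem_comap]
  -- `d ≤ 1`: Lefschetz `(1,1)` (or triviality in degree `0`) on `Y j`
  have hbd : b ∈ supportedClasses (Y j) (2 * d) d := by
    have hmj := hm j
    obtain rfl | rfl : d = 0 ∨ d = 1 := by omega
    · rw [supportedClasses_zero]
      exact Submodule.mem_top
    · exact hL (hY j) b hb hb'
  obtain ⟨S, hSc, hrS, hb0⟩ := exists_support_of_mem_supportedClasses hbd
  -- push forward: `(g j)_* b` dies off `g_j(S) ⊆ g_j(Y j) ⊆ Z`, closed of codimension `≥ p + 1`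
  have hf : IsClosedMap (g j).left.base :=
    haveI := isProper_left_of_isSmoothProjective (hY j) hX (g j)
    (g j).left.isClosedMap
  refine ⟨(g j).left.base '' S, ?_, hf _ hSc,
    fun w hw ↦ le_coheight_of_mem_image (hY j) hX (g j) hf hrS (by have := hm j; omega) hw,
    restrictCompl_complexGysin_eq_zero_of_image_subset hS μ hμ (hY j) hX (g j) (hf _ hSc)
      subset_rfl hd hb0⟩
  rintro _ ⟨y, -, rfl⟩
  rw [← hZg]
  exact Set.mem_iUnion_of_mem j ⟨y, rfl⟩

/-- **Rational Hodge classes of degree `2p + 2` supported in codimension `≥ p` are algebraic**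
(Voisin 2013, proof of Lemma 2.1 with `k = p + 1`, quoted in the module docstring; the argument
uses of `[Z]` only that it is a rational Hodge class), on the tree's carriers and from the tree's
named facts `hA` (Deligne, Cor. 8.2.8), `hB` (lifting of Hodge classes along Gysin surjections),
`hS` (Gysin maps and restriction), `hH` (projective Hironaka), `hL` (Lefschetz `(1,1)`), relative
to an orientation family `μ` with Poincaré duality: for `X` smooth projective of dimension `n`, a
rational class `c ∈ H^{2p+2}(X(ℂ); ℂ)` of Hodge type `(p+1, p+1)` lying in
`Nᵖ H^{2p+2} = supportedClasses X (2(p+1)) p` lies in `N^{p+1} H^{2p+2} = algebraicClasses X (p+1)`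
(`c` dies off one closed `Y` of codimension `≥ p`, `exists_support_of_mem_supportedClasses`, hence
off a closed `W ⊆ Y` of codimension `≥ p + 1`,
`exists_support_subset_of_restrictCompl_eq_zero_of_isOfHodgeType`).
[cite: Voisin2013GHCBloch, Lemma 2.1 (proof)] [cite: GrothendieckTopology1969, p. 300]
[cite: DeligneHodgeIII1974, Cor. 8.2.8] [cite: Voisin2025, Cor. 2.12]
[cite: VoisinHodgeI2002, Thm. 11.30 and §11.3.3] -/
theorem mem_algebraicClasses_of_mem_supportedClasses_of_isOfHodgeType
    (hA : Deligne1974_ker_restrictCompl_eq_iSup_range_complexGysin)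
    (hB : Voisin2025_hodgeClass_lift_complexGysin)
    (hS : gysinMap_restrictCompl_eq_zero.{0, 0} ℂ)
    (hH : Resolution.Hironaka1964_projective.{0}) (hL : lefschetzOneOne_rational)
    (μ : OrientationFamily) (hμ : μ.HasPoincareDuality) (hX : Motives.IsSmoothProjective n X)
    (p : ℕ) {c : complexBetti X (2 * (p + 1))} (hcs : c ∈ supportedClasses X (2 * (p + 1)) p)
    (hc : IsRationalClass c) (hc' : IsOfHodgeType n X (2 * (p + 1)) (p + 1) (p + 1) c) :
    c ∈ algebraicClasses X (p + 1) := by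
  obtain ⟨Z, hZ, hrZ, h0⟩ := exists_support_of_mem_supportedClasses hcs
  obtain ⟨W, -, hW, hrW, h0W⟩ := exists_support_subset_of_restrictCompl_eq_zero_of_isOfHodgeType
    hA hB hS hH hL μ hμ hX p hZ hrZ h0 hc hc'
  exact mem_supportedClasses_of_restrictCompl_eq_zero hW hrW h0W

/-- **Voisin 2013, proof of Lemma 2.1, in the shape of the route item
`SubmaximalConiveauHodgeClassesAlgebraic`** (`Summits/HodgeConjecture/HodgeConjecture/Theses/
ConiveauLadderCubicEightfolds`): granted the tree's named facts `hA` (Deligne, Hodge III,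
Cor. 8.2.8), `hB` (lifting of Hodge classes along Gysin surjections, Voisin 2025 Cor. 2.12), `hS`
(Gysin maps and restriction to open subsets, Fulton App. B Ex. 5), `hH` (projective Hironaka) and
`hL` (Lefschetz `(1,1)`), and an orientation family `μ` with Poincaré duality, on every smooth
projective `X/ℂ` a rational class of Hodge type `(p+1, p+1)` in `H^{2p+2}(X(ℂ); ℂ)` supported in
codimension `≥ p` is algebraic. The slice `p = 0` is Lefschetz `(1,1)` itself
(`mem_algebraicClasses_one_of_isOfHodgeType`). [cite: Voisin2013GHCBloch, Lemma 2.1 (proof)]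
[cite: DeligneHodgeIII1974, Cor. 8.2.8] [cite: Voisin2025, Cor. 2.12] -/
theorem supportedHodgeClass_algebraic_of_facts
    (hA : Deligne1974_ker_restrictCompl_eq_iSup_range_complexGysin)
    (hB : Voisin2025_hodgeClass_lift_complexGysin)
    (hS : gysinMap_restrictCompl_eq_zero.{0, 0} ℂ)
    (hH : Resolution.Hironaka1964_projective.{0}) (hL : lefschetzOneOne_rational)
    (μ : OrientationFamily) (hμ : μ.HasPoincareDuality) :
    ∀ ⦃n : ℕ⦄ ⦃X : Motives.SchemeOver ℂ⦄, Motives.IsSmoothProjective n X →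
      ∀ (p : ℕ) (c : complexBetti X (2 * (p + 1))), c ∈ supportedClasses X (2 * (p + 1)) p →
        IsRationalClass c → IsOfHodgeType n X (2 * (p + 1)) (p + 1) (p + 1) c →
        c ∈ algebraicClasses X (p + 1) :=
  fun _ _ hX p _ hcs hc hc' ↦
    mem_algebraicClasses_of_mem_supportedClasses_of_isOfHodgeType hA hB hS hH hL μ hμ hX p hcs hc hc'

/-- **The slice `p = 0` is Lefschetz `(1,1)`** (no support hypothesis is needed since
`N⁰ H² = H²`, `supportedClasses_zero`): a rational `(1,1)`-class is a divisor class, from the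
named fact `lefschetzOneOne_rational` alone. [cite: VoisinHodgeI2002, Thm. 11.30 and §11.3.3] -/
theorem mem_algebraicClasses_one_of_isOfHodgeType (hL : lefschetzOneOne_rational)
    (hX : Motives.IsSmoothProjective n X) {c : complexBetti X (2 * (0 + 1))}
    (hc : IsRationalClass c) (hc' : IsOfHodgeType n X (2 * (0 + 1)) (0 + 1) (0 + 1) c) :
    c ∈ algebraicClasses X (0 + 1) :=
  hL hX c hc hc'

end HodgeTheory

end Literature.AlgebraicGeometry.HodgeTheory

end
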